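import Summits.CriticalPhenomena.PercolationContinuityZ3.Theorems.Transplant.FKDoubleFanMultifanBA
import Summits.CriticalPhenomena.PercolationContinuityZ3.Theorems.Transplant.FKDoubleFanOneSidedConeS
import HarnessLib

/-!
# Double fans `K₂ ∨ P_{m+1}`: the TWO-SIDED dominance cone over the semialgebraic relaxation `InS` — (CL-a)_S ∧ (CL-b)_S give the far
# cross-apex theorem for every middle, and (CL-a)_S alone gives every "B·A·B" middle

Helper file (`--supports stmt-CriticalPhenomena-4575`), FK sub-lane `prim-bschramm-fk-3` (gen 41); builds on p205010 (kernel theorem, internal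
audit signed; external expert review pending).  No named facts, no sorries; standard axioms.  Memo `bschramm/prim-bschramm-fk-3/FAR-CROSS-XVI.md`.

`…OneSidedDominance` (gen 36) reduced the far cross-apex theorem for ALL middles to two closure statements `HypA`, `HypB` about the bi-dual of the
one-sided images `imgA q F w`, `imgB q G w` over the inductive class `InKE q`; `…OneSidedConeS` (gen 37) replaced `InKE` by the EXPLICIT class
`InS q = Valid ∧ U_a ∧ U_b ∧ U_c` for the `a`-sided cone, whose single closure statement `HypBaS` is FALSE (`…OneSidedConeSRefuted`, gen 40).
This file states the two-sided cone over `InS`: the dual **`TSDualS q`** of `{imgA q F w} ∪ {imgB q G w}`, `F, G, w ∈ InS q`, its bi-dual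
**`tsConeS q`** (it contains the inputs, **`input_mem_tsConeS`**, and the refuting witness of gen 40, which is a `b`-image), and the two closure
statements
  **(CL-a)_S** `HypAS q`: `opAC x (imgB q G w) ∈ tsConeS q`,   **(CL-b)_S** `HypBS q`: `opBC y (imgA q F w) ∈ tsConeS q`   (`F, G, w ∈ InS q`).
Both targets pair `≥ 0` with every target bivector by LEMMA′ and its mirror ON THE RELAXATION (`fanPhi_nonneg_validU`; **`target_tsDualS`**), so
(**`isLetterCone_tsConeS`**, **`negCorr_spokes_cross_far_of_hypABS`**): (CL-a)_S ∧ (CL-b)_S at `q ∈ (0,1]` ⟹ `φ(J_{ac_j} ∩ J_{bc_k}) ≤ φ(J_{ac_j})φ(J_{bc_k})`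
for every weighted double fan, all `j < k`, NO restriction on the middle.  And (CL-a)_S ALONE ⟹ the same for every middle of spoke pattern "B·A·B"
(**`negCorr_spokes_cross_far_bab_of_hypAS`**; the `b`-fan-transported targets are in `TSDualS` by MULTIFAN₁ on the relaxation, `mfRay_nonneg_of_goodIJ`).
NUMERICS (memo FAR-CROSS-XVI §0(B), §4; CORRECTED 2026-08-27 — the runs j282623–26 / j282655–61 first cited here used a tangent family
without feasibility checks, which made the margin LP vacuous, and are VOID): with the optimizer oracle alone (kit j282211/14/17/20) every cell is a
member at `q ∈ {0.55, 0.7}` and gen 40's "tight" cell at `q = 0.4` is a member (atom poverty); with FEASIBILITY-CHECKED tangent atoms and the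
pointedness / explicit-decomposition guards (kit j284330–48, j284408–16) the tested (CL-a)_S / (CL-b)_S targets — gadgets `B_yE_r`, `E_{r₂}B_yE_{r₁}`,
rests `BC`, `AC∗BC`, `AB∗BC`, and the vectors `Λ(x,y) = ∧²(A_xB_y)(a∧b)`, `∧²(A_xB_yE_r)β_w` — are EXPLICIT members (NNLS `t = Σλ_i a_i`, residual
`≤ 10⁻¹²`, `Σλ ≈ 1`, ≤ 10 atoms) wherever the final dictionary stayed pointed (`q ∈ {0.1, 0.25, 0.4, 0.7}`); at `q = 0.05` several dictionaries
degenerated and those verdicts are open (memo §4).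
[folklore]
-/

noncomputable section

namespace Summit.CriticalPhenomena.PercolationContinuityZ3.Theorems

namespace FK

namespace ThreeApex

/-! ### The two-sided dual and bi-dual over `InS` -/

/-- The dual of the two-sided images over the relaxation: bivectors pairing `≥ 0` with every `imgA q F w` and every `imgB q G w`,
`F, G, w ∈ InS q`. [folklore] -/
def TSDualS (q : ℝ) (γ : Biv) : Prop :=
  (∀ F w : V5, InS q F → InS q w → 0 ≤ pairH q (imgA q F w) γ) ∧ (∀ G w : V5, InS q G → InS q w → 0 ≤ pairH q (imgB q G w) γ)

/-- **The two-sided dominance cone over `InS`**: the closed convex cone bi-dual to the two-sided images. [folklore] -/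
def tsConeS (q : ℝ) : Set Biv := {β | ∀ γ : Biv, TSDualS q γ → 0 ≤ pairH q β γ}

/-- `a`-images lie in the cone. [folklore] -/
theorem imgA_mem_tsConeS {q : ℝ} {F w : V5} (hF : InS q F) (hw : InS q w) : imgA q F w ∈ tsConeS q :=
  fun _ hγ => hγ.1 F w hF hw

/-- `b`-images lie in the cone. [folklore] -/
theorem imgB_mem_tsConeS {q : ℝ} {G w : V5} (hG : InS q G) (hw : InS q w) : imgB q G w ∈ tsConeS q :=
  fun _ hγ => hγ.2 G w hG hw

/-- **Inputs lie in the cone** (`u ∈ InKE q`, `0 < q ≤ 1`). [folklore] -/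
theorem input_mem_tsConeS {q : ℝ} (hq0 : 0 < q) (hq1 : q ≤ 1) {u : V5} (hu : InKE q u) :
    wedgeH (conv (edgeAC 0) u) (conv (edgeAC 1) u) ∈ tsConeS q := by
  rw [← imgA_fanInit]; exact imgA_mem_tsConeS ((fanInit_inKE q).inS hq0 hq1) (hu.inS hq0 hq1)

/-- The two-sided dual refines the one-sided one. [folklore] -/
theorem TSDualS.osDualS {q : ℝ} {γ : Biv} (h : TSDualS q γ) : OSDualS q γ := h.1

/-- Hence the one-sided relaxation cone is contained in the two-sided one. [folklore] -/
theorem osConeS_subset_tsConeS (q : ℝ) : osConeS q ⊆ tsConeS q :=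
  fun _ hβ γ hγ => hβ γ hγ.osDualS

/-- **(CL-a)_S**: every `a`-spoke applied to every `b`-image over `InS` stays in the cone. [folklore] -/
def HypAS (q : ℝ) : Prop := ∀ (G w : V5) (x : ℝ), InS q G → InS q w → 0 ≤ x → x ≤ 1 → opAC x (imgB q G w) ∈ tsConeS q

/-- **(CL-b)_S**: every `b`-spoke applied to every `a`-image over `InS` stays in the cone. [folklore] -/
def HypBS (q : ℝ) : Prop := ∀ (F w : V5) (y : ℝ), InS q F → InS q w → 0 ≤ y → y ≤ 1 → opBC y (imgA q F w) ∈ tsConeS q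

namespace TSDualS

variable {q : ℝ} {γ : Biv}

/-- The dual is stable under rim steps (`0 < q ≤ 1`). [folklore] -/
theorem rim (hq0 : 0 < q) (hq1 : q ≤ 1) (hγ : TSDualS q γ) {r : ℝ} (hr0 : 0 ≤ r) (hr1 : r ≤ 1) : TSDualS q (opE q r γ) := by
  refine ⟨fun F w hF hw => ?_, fun G w hG hw => ?_⟩
  · rw [← pairH_opE, opE_imgA]; exact hγ.1 _ _ (hF.rimStep hq0 hq1 hr0 hr1) hw
  · rw [← pairH_opE, opE_imgB]; exact hγ.2 _ _ (hG.rimStep hq0 hq1 hr0 hr1) hw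

/-- The dual is stable under `a`-spokes, given (CL-a)_S (`0 < q ≤ 1`). [folklore] -/
theorem ac (hq0 : 0 < q) (hq1 : q ≤ 1) (hγ : TSDualS q γ) (hA : HypAS q) {x : ℝ} (hx0 : 0 ≤ x) (hx1 : x ≤ 1) :
    TSDualS q (opAC x γ) := by
  refine ⟨fun F w hF hw => ?_, fun G w hG hw => ?_⟩
  · rw [← pairH_opAC, opAC_imgA]; exact hγ.1 _ _ (hF.step hq0 hq1 (IsLetter.bc hx0 hx1)) hw
  · rw [← pairH_opAC]; exact hA G w x hG hw hx0 hx1 γ hγ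

/-- The dual is stable under `b`-spokes, given (CL-b)_S (`0 < q ≤ 1`). [folklore] -/
theorem bc (hq0 : 0 < q) (hq1 : q ≤ 1) (hγ : TSDualS q γ) (hB : HypBS q) {y : ℝ} (hy0 : 0 ≤ y) (hy1 : y ≤ 1) :
    TSDualS q (opBC y γ) := by
  refine ⟨fun F w hF hw => ?_, fun G w hG hw => ?_⟩
  · rw [← pairH_opBC]; exact hB F w y hF hw hy0 hy1 γ hγ
  · rw [← pairH_opBC, opBC_imgB]; exact hγ.2 _ _ (hG.step hq0 hq1 (IsLetter.bc hy0 hy1)) hw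

end TSDualS

/-- The cone is stable under rim steps (unconditionally; `0 < q ≤ 1`). [folklore] -/
theorem tsConeS_opE {q : ℝ} (hq0 : 0 < q) (hq1 : q ≤ 1) {β : Biv} (hβ : β ∈ tsConeS q) {r : ℝ} (hr0 : 0 ≤ r) (hr1 : r ≤ 1) :
    opE q r β ∈ tsConeS q :=
  fun γ hγ => by rw [pairH_opE]; exact hβ _ (hγ.rim hq0 hq1 hr0 hr1)

/-- The cone is stable under `a`-spokes, given (CL-a)_S. [folklore] -/
theorem tsConeS_opAC {q : ℝ} (hq0 : 0 < q) (hq1 : q ≤ 1) (hA : HypAS q) {β : Biv} (hβ : β ∈ tsConeS q) {x : ℝ} (hx0 : 0 ≤ x)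
    (hx1 : x ≤ 1) : opAC x β ∈ tsConeS q :=
  fun γ hγ => by rw [pairH_opAC]; exact hβ _ (hγ.ac hq0 hq1 hA hx0 hx1)

/-- **Under (CL-a)_S and (CL-b)_S the two-sided relaxation cone is a letter cone** (`0 < q ≤ 1`). [folklore] -/
theorem isLetterCone_tsConeS {q : ℝ} (hq0 : 0 < q) (hq1 : q ≤ 1) (hA : HypAS q) (hB : HypBS q) : IsLetterCone q (tsConeS q) where
  zero_mem := fun γ _ => le_of_eq (pairH_zero_left q γ).symm
  add_mem := fun β γ hβ hγ δ hδ => by rw [pairH_add_left]; exact add_nonneg (hβ δ hδ) (hγ δ hδ)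
  smul_mem := fun a β ha hβ δ hδ => by rw [pairH_smul_left]; exact mul_nonneg ha (hβ δ hδ)
  rim := fun r β hr0 hr1 hβ γ hγ => by rw [pairH_opE]; exact hβ _ (hγ.rim hq0 hq1 hr0 hr1)
  ac := fun x β hx0 hx1 hβ γ hγ => by rw [pairH_opAC]; exact hβ _ (hγ.ac hq0 hq1 hA hx0 hx1)
  bc := fun y β hy0 hy1 hβ γ hγ => by rw [pairH_opBC]; exact hβ _ (hγ.bc hq0 hq1 hB hy0 hy1)

/-! ### Targets lie in the two-sided dual: LEMMA′ and its mirror on the relaxation -/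

/-- **LEMMA′'s mirror on the relaxation**: `Φ_q(swapAC G; swapAB s, swapAB w) ≥ 0` for `G, w ∈ InS q`, `s ∈ InKE q`, `0 < q < 1`. [folklore] -/
theorem fanPhi_mirror_nonneg_inS {q : ℝ} (hq0 : 0 < q) (hq1 : q < 1) {G w s : V5} (hG : InS q G) (hw : InS q w) (hs : InKE q s) :
    0 ≤ fanPhi q (swapAC G) (swapAB s) (swapAB w) := by
  refine fanPhi_nonneg_validU hq0 hq1 (nonneg_swapAC hG.valid.nonneg) ?_ (nonneg_swapAB (hs.valid hq0.le hq1.le).nonneg) ?_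
    (nonneg_swapAB hw.valid.nonneg) hw.ub
  · rw [swapAC_swapAC]; exact hG.ua
  · rw [swapAB_swapAB]; exact hs.uCond hq0 hq1.le

/-- **Every target lies in the two-sided `InS`-dual** (`0 < q < 1`, `s ∈ InKE q`). [folklore] -/
theorem target_tsDualS {q : ℝ} (hq0 : 0 < q) (hq1 : q < 1) {s : V5} (hs : InKE q s) :
    TSDualS q (wedgeH (conv s (edgeBC 0)) (conv s (edgeBC 1))) := by
  refine ⟨fun F w hF hw => target_osDualS hq0 hq1 hs F w hF hw, fun G w hG hw => ?_⟩
  have hq2 : (q ^ 2 : ℝ) ≠ 0 := pow_ne_zero 2 hq0.ne'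
  rw [mul_left_cancel₀ hq2 (pairH_imgB_target q G w s)]
  exact fanPhi_mirror_nonneg_inS hq0 hq1 hG hw hs

/-- The cone pairs non-negatively with every target (`0 < q < 1`). [folklore] -/
theorem pairH_tsConeS_target {q : ℝ} (hq0 : 0 < q) (hq1 : q < 1) {s : V5} (hs : InKE q s) :
    ∀ β, β ∈ tsConeS q → 0 ≤ pairH q β (wedgeH (conv s (edgeBC 0)) (conv s (edgeBC 1))) :=
  fun _ hβ => hβ _ (target_tsDualS hq0 hq1 hs)

/-! ### The reduction: (CL-a)_S ∧ (CL-b)_S ⟹ the far cross-apex pair for every middle -/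

/-- At `q = 1` the Rayleigh difference of the `crossFarZ` valuations vanishes identically. [folklore] -/
theorem rayleigh_crossFar_one (mids : List (ℝ × ℝ × ℝ)) (rd : ℝ) (u s : V5) :
    crossFarZ 1 mids rd u s 1 0 * crossFarZ 1 mids rd u s 0 1 - crossFarZ 1 mids rd u s 1 1 * crossFarZ 1 mids rd u s 0 0 = 0 := by
  simp only [crossFarZ, conv_conv_edgeBC_assoc]
  rw [rayleigh_eq_pairH', pairH_one, mul_zero]

/-- **(CL-a)_S ∧ (CL-b)_S ⟹ THE ALGEBRA-LEVEL FAR THEOREM** (`0 < q ≤ 1`): the hypothesis `halg` of `negCorr_spokes_cross_far_of_inKE` in full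
generality. [folklore] -/
theorem rayleigh_crossFar_of_hypABS {q : ℝ} (hq0 : 0 < q) (hq1 : q ≤ 1) (hA : HypAS q) (hB : HypBS q) :
    ∀ (mids : List (ℝ × ℝ × ℝ)), UnitBlocks mids → ∀ rd : ℝ, 0 ≤ rd → rd ≤ 1 → ∀ u s : V5, InKE q u → InKE q s →
      0 ≤ crossFarZ q mids rd u s 1 0 * crossFarZ q mids rd u s 0 1 - crossFarZ q mids rd u s 1 1 * crossFarZ q mids rd u s 0 0 := by
  intro mids hm rd hrd0 hrd1 u s hu hs
  rcases eq_or_lt_of_le hq1 with h1 | h1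
  · subst h1; rw [rayleigh_crossFar_one]
  · have key := rayleigh_crossFar_of_isLetterCone (isLetterCone_tsConeS hq0 hq1 hA hB) hm hrd0 hrd1 (input_mem_tsConeS hq0 hq1 hu)
      (pairH_tsConeS_target hq0 h1 hs)
    simp only [crossFarZ]
    linarith [key]

open MeasureTheory Literature.Probability.LatticeModels Literature.Probability.Percolation
open scoped Classical

variable {V : Type*} [Fintype V]

section Setting

variable {a b : V} {c : ℕ → V} {m : ℕ}
variable (hab : a ≠ b) (hinj : ∀ j k, j ≤ m → k ≤ m → c j = c k → j = k) (hca : ∀ j, j ≤ m → c j ≠ a) (hcb : ∀ j, j ≤ m → c j ≠ b)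
include hab hinj hca hcb

/-- **(CL-a)_S ∧ (CL-b)_S ⟹ NEGATIVE CORRELATION OF EVERY CROSS-APEX PAIR AT EVERY DISTANCE.**  If the two closure statements over the explicit
class `InS q` hold at `q ∈ (0,1]`, then for every weighted double fan (`card V = m + 3`, weights supported on the double-fan pairs) and all
`j < k ≤ m`: `φ(J_{a c_j} ∩ J_{b c_k}) ≤ φ(J_{a c_j})·φ(J_{b c_k})` — no restriction on the middle. [folklore] -/
theorem negCorr_spokes_cross_far_of_hypABS (hcard : Fintype.card V = m + 3) {q : ℝ} (hq0 : 0 < q) (hq1 : q ≤ 1)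
    (w : Sym2 V → unitInterval) (hsupp : ∀ e, e ∉ dfPairs a b c m → w e = 0) (hA : HypAS q) (hB : HypBS q)
    {j k : ℕ} (hjk : j < k) (hk : k ≤ m) :
    (rcMeasureW w q ∅).real ({ω : BondConfig V | s(a, c j) ∈ ω} ∩ {ω | s(b, c k) ∈ ω}) ≤
      (rcMeasureW w q ∅).real {ω : BondConfig V | s(a, c j) ∈ ω} * (rcMeasureW w q ∅).real {ω : BondConfig V | s(b, c k) ∈ ω} :=
  negCorr_spokes_cross_far_of_inKE hab hinj hca hcb hcard hq0 w hsupp (rayleigh_crossFar_of_hypABS hq0 hq1 hA hB) hjk hk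

end Setting

/-! ### (CL-a)_S alone: the `a`-only walk and the `b`-fan-transported targets over the relaxation -/

/-- **The `a`-only walk in the relaxation cone**: under (CL-a)_S, an `a`-only block list keeps a pair of vectors whose wedge lies in
`tsConeS q` inside `tsConeS q` (`0 < q ≤ 1`). [folklore] -/
theorem tsConeS_midWord_aOnly {q : ℝ} (hq0 : 0 < q) (hq1 : q ≤ 1) (hA : HypAS q) :
    ∀ {ma : List (ℝ × ℝ × ℝ)}, UnitBlocks ma → (∀ blk ∈ ma, blk.2.2 = 0) →
      ∀ {X Y : V5}, wedgeH X Y ∈ tsConeS q → wedgeH (midWord q ma X) (midWord q ma Y) ∈ tsConeS q := by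
  intro ma
  induction ma with
  | nil => intro _ _ X Y h; simpa [midWord] using h
  | cons blk rest ih =>
    intro hm h0 X Y h
    have hb := hm blk (by simp)
    have hrest : UnitBlocks rest := fun b hb' => hm b (by simp [hb'])
    have h0rest : ∀ b ∈ rest, b.2.2 = 0 := fun b hb' => h0 b (by simp [hb'])
    have hy : blk.2.2 = 0 := h0 blk (by simp)
    simp only [midWord, hy, conv_edgeBC_zero]
    refine ih hrest h0rest ?_
    rw [← opAC_wedgeH]
    refine tsConeS_opAC hq0 hq1 hA ?_ hb.2.2.1 hb.2.2.2.1
    rw [← opE_wedgeH]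
    exact tsConeS_opE hq0 hq1 h hb.1 hb.2.1

/-- **The `b`-fan-transported targets lie in the two-sided `InS`-dual** (`0 < q < 1`): for a `b`-only block list `mb`, `rd ∈ [0,1]`, `s ∈ InKE q`
and `G₂ = E_{rd}(fanVecB q mb fanInit)`, the bivector `(fanComboBrev G₂ (s∗BC_0)) ∧ (fanComboBrev G₂ (s∗BC_1))` pairs `≥ 0` with every `imgA q F w`,
`F, w ∈ InS q` (MULTIFAN₁ on the relaxation, `mfRay_nonneg_of_goodIJ`) and with every `imgB q G w`, `G, w ∈ InS q` (series composition and LEMMA′'s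
mirror on the relaxation). [folklore] -/
theorem tsDualS_bTarget {q : ℝ} (hq0 : 0 < q) (hq1 : q < 1) {mb : List (ℝ × ℝ × ℝ)} (hmb : UnitBlocks mb) (hb : ∀ blk ∈ mb, blk.2.1 = 0)
    {rd : ℝ} (hrd0 : 0 ≤ rd) (hrd1 : rd ≤ 1) {s : V5} (hs : InKE q s) :
    TSDualS q (wedgeH (fanComboBrev q (rimStep q rd (fanVecB q mb fanInit)) (conv s (edgeBC 0)))
      (fanComboBrev q (rimStep q rd (fanVecB q mb fanInit)) (conv s (edgeBC 1)))) := by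
  set G₂ := rimStep q rd (fanVecB q mb fanInit) with hG₂
  have hG₂K : InKE q G₂ := InKE.rim hrd0 hrd1 (fanVecB_inKE hmb (fanInit_inKE q))
  have hG₂S : InS q G₂ := hG₂K.inS hq0 hq1.le
  have hsV := hs.valid hq0.le hq1.le
  have hq2 : (0 : ℝ) < q ^ 2 := pow_pos hq0 2
  refine ⟨fun F w hF hw => ?_, fun G w hG hw => ?_⟩
  · -- MULTIFAN₁ on the relaxation
    have key : 0 ≤ mfRay q F G₂ w s :=
      mfRay_nonneg_of_goodIJ hq0 hq1 (goodIJ_endpoints hq0.le hq1.le) hF.valid.nonneg hF.uc hG₂S.valid.nonneg hG₂S.ua hw.valid.nonneg hw.ub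
        hsV.nonneg (hs.uCond hq0 hq1.le)
    rw [mfRay, mfZ_eq_brev, mfZ_eq_brev, mfZ_eq_brev, mfZ_eq_brev, rayleigh_eq_pairH'] at key
    simp only [imgA]
    exact (mul_nonneg_iff_of_pos_left hq2).mp key
  · -- two `b`-fans in series, then LEMMA′'s mirror on the relaxation
    have hG''K : InS q (rimStep q rd (fanVecB q mb G)) := by
      refine InS.rimStep hq0 hq1.le hrd0 hrd1 ?_
      clear hG₂ hG₂K hG₂S G₂
      induction mb generalizing G with
      | nil => simpa [fanVecB] using hG
      | cons blk rest ih =>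
        have hbk := hmb blk (by simp)
        have hrest : UnitBlocks rest := fun b hb' => hmb b (by simp [hb'])
        have hbrest : ∀ b ∈ rest, b.2.1 = 0 := fun b hb' => hb b (by simp [hb'])
        simp only [fanVecB]
        exact ih hrest hbrest _ (InS.step hq0 hq1.le (IsLetter.bc hbk.2.2.2.2.1 hbk.2.2.2.2.2) (hG.rimStep hq0 hq1.le hbk.1 hbk.2.1))
    have hser : ∀ X : V5, fanComboB q G₂ (fanComboB q G X) = fanComboB q (rimStep q rd (fanVecB q mb G)) X := by
      intro X
      rw [hG₂, ← rimStep_fanComboB, fanComboB_fanVecB q hb, rimStep_fanComboB]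
    have e : ∀ σ τ : ℝ, val q (conv (fanComboBrev q G₂ (conv s (edgeBC τ))) (fanComboB q G (conv (edgeAC σ) w))) =
        val q (conv (conv s (edgeBC τ)) (fanComboB q (rimStep q rd (fanVecB q mb G)) (conv (edgeAC σ) w))) := by
      intro σ τ; rw [← val_conv_fanComboB, hser]
    have key := (target_tsDualS hq0 hq1 hs).2 _ w hG''K hw
    have id := rayleigh_eq_pairH' q (fanComboB q G (conv (edgeAC 0) w)) (fanComboB q G (conv (edgeAC 1) w))
      (fanComboBrev q G₂ (conv s (edgeBC 0))) (fanComboBrev q G₂ (conv s (edgeBC 1)))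
    have id2 := rayleigh_eq_pairH' q (fanComboB q (rimStep q rd (fanVecB q mb G)) (conv (edgeAC 0) w))
      (fanComboB q (rimStep q rd (fanVecB q mb G)) (conv (edgeAC 1) w)) (conv s (edgeBC 0)) (conv s (edgeBC 1))
    rw [e, e, e, e] at id
    simp only [imgB] at key ⊢
    have h4 : 0 ≤ q ^ 2 * pairH q (wedgeH (fanComboB q G (conv (edgeAC 0) w)) (fanComboB q G (conv (edgeAC 1) w)))
        (wedgeH (fanComboBrev q G₂ (conv s (edgeBC 0))) (fanComboBrev q G₂ (conv s (edgeBC 1)))) := by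
      rw [← id, id2]; exact mul_nonneg hq2.le key
    exact (mul_nonneg_iff_of_pos_left hq2).mp h4

section Setting

variable {a b : V} {c : ℕ → V} {m : ℕ}
variable (hab : a ≠ b) (hinj : ∀ j k, j ≤ m → k ≤ m → c j = c k → j = k) (hca : ∀ j, j ≤ m → c j ≠ a) (hcb : ∀ j, j ≤ m → c j ≠ b)
include hab hinj hca hcb

/-- **(CL-a)_S ALONE ⟹ NEGATIVE CORRELATION FOR EVERY MIDDLE OF SPOKE PATTERN "B·A·B".**  If `HypAS q` holds at `q ∈ (0,1]`, then for every
weighted double fan (`card V = m + 3`, weights supported on the double-fan pairs) and all `j ≤ ℓ₁ ≤ ℓ₂ < k ≤ m` with `w(a c_i) = 0` for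
`j < i ≤ ℓ₁`, `w(b c_i) = 0` for `ℓ₁ < i ≤ ℓ₂` and `w(a c_i) = 0` for `ℓ₂ < i < k`, the pair `(a c_j, b c_k)` is negatively correlated. [folklore] -/
theorem negCorr_spokes_cross_far_bab_of_hypAS (hcard : Fintype.card V = m + 3) {q : ℝ} (hq0 : 0 < q) (hq1 : q ≤ 1)
    (w : Sym2 V → unitInterval) (hsupp : ∀ e, e ∉ dfPairs a b c m → w e = 0) (hA : HypAS q)
    {j ℓ₁ ℓ₂ k : ℕ} (hj1 : j ≤ ℓ₁) (h12 : ℓ₁ ≤ ℓ₂) (h2k : ℓ₂ < k) (hk : k ≤ m)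
    (ha1 : ∀ i, j < i → i ≤ ℓ₁ → w s(a, c i) = 0) (hb2 : ∀ i, ℓ₁ < i → i ≤ ℓ₂ → w s(b, c i) = 0)
    (ha3 : ∀ i, ℓ₂ < i → i < k → w s(a, c i) = 0) :
    (rcMeasureW w q ∅).real ({ω : BondConfig V | s(a, c j) ∈ ω} ∩ {ω | s(b, c k) ∈ ω}) ≤
      (rcMeasureW w q ∅).real {ω : BondConfig V | s(a, c j) ∈ ω} * (rcMeasureW w q ∅).real {ω : BondConfig V | s(b, c k) ∈ ω} := by
  obtain ⟨d, rfl⟩ : ∃ d, k = j + d + 1 := ⟨k - j - 1, by omega⟩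
  refine negCorr_spokes_cross_far_of_rayleigh hab hinj hca hcb hcard hq0 w hsupp hk ?_
  have huK : InKE q (conv (edgeBC (wR w s(b, c j))) (blockIn q w a b c j)) :=
    InKE.step (IsLetter.bc (w _).2.1 (w _).2.2) (inKE_blockIn q w a b c j)
  have hsK : InKE q (conv (restVec q w a b c (j + d + 1) (m - (j + d + 1))) (edgeAC (wR w s(a, c (j + d + 1))))) :=
    InKE.mul (inKE_restVec q w a b c (m - (j + d + 1)) (j + d + 1)) (by
      rw [← mul_one (edgeAC (wR w s(a, c (j + d + 1)))), mul_def, one_def]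
      exact InKE.step (IsLetter.ac (w _).2.1 (w _).2.2) InKE.base)
  set n₁ := ℓ₁ - j with hn₁
  set n₂ := ℓ₂ - ℓ₁ with hn₂
  obtain ⟨n₃, hn₃⟩ : ∃ n₃, d = (n₁ + n₂) + n₃ := ⟨d - (n₁ + n₂), by omega⟩
  have hsplit : midBlocks w a b c j d =
      (midBlocks w a b c j n₁ ++ midBlocks w a b c (j + n₁) n₂) ++ midBlocks w a b c (j + (n₁ + n₂)) n₃ := by
    rw [hn₃, midBlocks_split w a b c j (n₁ + n₂) n₃, midBlocks_split w a b c j n₁ n₂]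
  have hx1 : ∀ blk ∈ midBlocks w a b c j n₁, blk.2.1 = 0 :=
    midBlocks_aSpoke_zero w a b c j n₁ (fun i hi hi' => ha1 i hi (by omega))
  have hy2 : ∀ blk ∈ midBlocks w a b c (j + n₁) n₂, blk.2.2 = 0 :=
    midBlocks_bSpoke_zero w a b c (j + n₁) n₂ (fun i hi hi' => hb2 i (by omega) (by omega))
  have hx3 : ∀ blk ∈ midBlocks w a b c (j + (n₁ + n₂)) n₃, blk.2.1 = 0 :=
    midBlocks_aSpoke_zero w a b c (j + (n₁ + n₂)) n₃ (fun i hi hi' => ha3 i (by omega) (by omega))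
  set mb₁ := midBlocks w a b c j n₁
  set ma := midBlocks w a b c (j + n₁) n₂
  set mb₂ := midBlocks w a b c (j + (n₁ + n₂)) n₃
  set rd := wR w s(c (j + d), c (j + d + 1))
  set u := conv (edgeBC (wR w s(b, c j))) (blockIn q w a b c j)
  set s := conv (restVec q w a b c (j + d + 1) (m - (j + d + 1))) (edgeAC (wR w s(a, c (j + d + 1))))
  have hrd0 : 0 ≤ rd := (w _).2.1
  have hrd1 : rd ≤ 1 := (w _).2.2
  set G₁ := fanVecB q mb₁ fanInit
  set G₂ := rimStep q rd (fanVecB q mb₂ fanInit)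
  have hG₁ : InKE q G₁ := fanVecB_inKE (unitBlocks_midBlocks w a b c j n₁) (fanInit_inKE q)
  set X : ℝ → V5 := fun σ => midWord q ma (fanComboB q G₁ (conv (edgeAC σ) u))
  set Y : ℝ → V5 := fun τ => fanComboBrev q G₂ (conv s (edgeBC τ))
  have hZ : ∀ σ τ : ℝ, crossFarZ q (midBlocks w a b c j d) rd u s σ τ = val q (conv (Y τ) (X σ)) := by
    intro σ τ
    simp only [crossFarZ, hsplit, midWord_appendList, X, Y]
    rw [midWord_oneSidedB_init q hx1, midWord_oneSidedB_init q hx3, rimStep_fanComboB, conv_conv_edgeBC_assoc, val_conv_fanComboB]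
  rcases eq_or_lt_of_le hq1 with h1 | h1
  · -- `q = 1`: the difference vanishes
    subst h1
    have e0 := rayleigh_eq_pairH' 1 (X 0) (X 1) (Y 0) (Y 1)
    rw [pairH_one, mul_zero] at e0
    simp only
    rw [hZ, hZ, hZ, hZ]
    linarith [e0]
  · have hmem : wedgeH (X 0) (X 1) ∈ tsConeS q :=
      tsConeS_midWord_aOnly hq0 hq1 hA (unitBlocks_midBlocks w a b c (j + n₁) n₂) hy2
        (imgB_mem_tsConeS (hG₁.inS hq0 hq1) (huK.inS hq0 hq1))
    have hdual : TSDualS q (wedgeH (Y 0) (Y 1)) :=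
      tsDualS_bTarget hq0 h1 (unitBlocks_midBlocks w a b c (j + (n₁ + n₂)) n₃) hx3 hrd0 hrd1 hsK
    have hpos : ∀ β, β ∈ tsConeS q → 0 ≤ pairH q β (wedgeH (Y 0) (Y 1)) := fun β hβ => hβ _ hdual
    have key := rayleigh_of_isOpCone hmem hpos
    have e : ∀ A B : V5, conv A B = conv B A := fun A B => by simp only [← mul_def]; ac_rfl
    simp only
    rw [hZ, hZ, hZ, hZ, e (Y 1) (X 1), e (Y 0) (X 0), e (Y 0) (X 1), e (Y 1) (X 0)]
    linarith [key]

end Setting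

end ThreeApex

end FK

end Summit.CriticalPhenomena.PercolationContinuityZ3.Theorems
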